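import Mathlib.RingTheory.LaurentSeries
import Mathlib.RingTheory.HahnSeries.Summable
import Mathlib.Algebra.Order.Group.Basic
import HarnessLib

/-!
# Sinnott's lemma: rational functions of pairwise independent monomials

Topic `Literature/NumberTheory/LFunctions`; namespace `Literature.NumberTheory.LFunctions.Sinnott1987`.
THEOREMS ONLY (one auxiliary `def`, the Laurent-expansion embedding; no named facts).

This is the Appendix of W. Sinnott, *On a theorem of L. Washington*, Astérisque 147–148 (1987)
(= Prop. 3.1 of Sinnott, Invent. Math. 75 (1984)): *let `k` be a field and `Y₁, …, Y_m`
pairwise multiplicatively independent non-trivial Laurent monomials in `k[X₁^{±1}, …, X_n^{±1}]`;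
a relation `r₁(Y₁) + ⋯ + r_m(Y_m) = 0` with `r_j ∈ k(Z)` can occur only if every `r_j ∈ k`.*

We prove it in the following form, which is what the proof of Sinnott's Theorem 3.2 uses.  Let
`Γ` be a linearly ordered abelian group and `K = F⟦Γ⟧` the field of Hahn series.  For `y ∈ Γ`,
`y > 0`, the Laurent expansion at `Z = 0` followed by `t ↦ t • y` is a ring embedding
`laurentAt y : F(Z) →+* K` sending `Z ↦ single y 1`; any ring homomorphism `F(Z) → K` that is
the identity on constants and sends `Z` to `single y 1` coincides with it
(`ringHom_eq_laurentAt`).  **Theorem** (`isConstant_of_sum_laurentAt_eq_zero`): if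
`y_j > 0` (`j ∈ J`) are pairwise rationally independent (`a • y_i = b • y_j`, `a ≠ 0` only for
`i = j`) and `∑_j Φ_j(u_j) = 0` for such homomorphisms `Φ_j` and `u_j ∈ F(Z)`, then every `u_j`
is a constant.  Proof (Sinnott's, p. 223, "each element of `R` can be written uniquely as a
`k`-linear combination of elements of `M`"): the expansion of `u_j(Y_j)` is supported on the
multiples `t • y_j`, these supports are pairwise disjoint away from `0`, so all non-constant
Laurent coefficients of every `u_j` vanish.  (Sinnott reduces to Laurent polynomials through
unique factorisation first; expanding in the Hahn-series field makes that step unnecessary.)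

## References

* W. Sinnott, *On a theorem of L. Washington*, Astérisque 147–148 (1987), 209–224, Appendix
  (p. 223). [Sinnott1987]
* W. Sinnott, *On the μ-invariant of the Γ-transform of a rational function*, Invent. Math. 75
  (1984), 273–282, Prop. 3.1. [Sinnott1984]
-/

noncomputable section

open HahnSeries Polynomial
open scoped RatFunc LaurentSeries

namespace Literature.NumberTheory.LFunctions.Sinnott1987

variable {F : Type*} [Field F]
variable {Γ : Type*} [AddCommGroup Γ] [LinearOrder Γ] [IsOrderedAddMonoid Γ]

/-! ### The Laurent expansion along a positive element of `Γ` -/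

section LaurentAt

/-- `t ↦ t • y` is injective for `y > 0`. [folklore] -/
theorem zsmul_left_injective_of_pos {y : Γ} (hy : 0 < y) :
    Function.Injective fun t : ℤ ↦ t • y := by
  intro a b hab
  have h1 : a • y ≤ b • y := hab.le
  have h2 : b • y ≤ a • y := hab.ge
  rw [zsmul_le_zsmul_iff_left hy] at h1 h2
  exact le_antisymm h1 h2

/-- The embedding `F⸨Z⸩ →+* F⟦Γ⟧` along `t ↦ t • y` (`y > 0`). [folklore] -/
def alongHom {y : Γ} (hy : 0 < y) : LaurentSeries F →+* HahnSeries Γ F :=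
  embDomainRingHom (zmultiplesHom Γ y)
    (fun a b hab ↦ zsmul_left_injective_of_pos hy (by simpa using hab))
    (fun g g' ↦ by simpa using zsmul_le_zsmul_iff_left (m := g) (n := g') hy)

/-- The **Laurent expansion along `y`**: `F(Z) →+* F⟦Γ⟧`, `Z ↦ single y 1`, i.e.
`r ↦ ∑_t c_t(r) single (t • y)` where `∑ c_t Z^t` is the Laurent expansion of `r` at `Z = 0`.
[cite: Sinnott1987, Appendix] -/
def laurentAt {y : Γ} (hy : 0 < y) : RatFunc F →+* HahnSeries Γ F :=
  (alongHom hy).comp (algebraMap (RatFunc F) (LaurentSeries F))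

/-- Coefficients of the expansion along `y` at the multiples `t • y`. [folklore] -/
theorem laurentAt_coeff_zsmul {y : Γ} (hy : 0 < y) (r : RatFunc F) (t : ℤ) :
    (laurentAt hy r).coeff (t • y) = (r : LaurentSeries F).coeff t := by
  simp only [laurentAt, RingHom.coe_comp, Function.comp_apply, alongHom]
  exact embDomain_mk_coeff (f := fun t : ℤ ↦ t • y) _ _

/-- The expansion along `y` is supported on the multiples of `y`. [folklore] -/
theorem laurentAt_coeff_eq_zero {y : Γ} (hy : 0 < y) (r : RatFunc F) {g : Γ}
    (hg : ∀ t : ℤ, t • y ≠ g) : (laurentAt hy r).coeff g = 0 := by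
  simp only [laurentAt, RingHom.coe_comp, Function.comp_apply, alongHom, embDomainRingHom]
  refine embDomain_notin_range ?_
  rintro ⟨t, rfl⟩
  exact hg t (by simp)

/-- `Z ↦ single y 1`. [folklore] -/
theorem laurentAt_X {y : Γ} (hy : 0 < y) : laurentAt hy (RatFunc.X : RatFunc F) = single y 1 := by
  simp only [laurentAt, RingHom.coe_comp, Function.comp_apply]
  rw [show (algebraMap (RatFunc F) (LaurentSeries F)) RatFunc.X =
    ((RatFunc.X : RatFunc F) : LaurentSeries F) from rfl, RatFunc.coe_X]
  simp [alongHom, embDomainRingHom, embDomain_single]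

omit [LinearOrder Γ] [IsOrderedAddMonoid Γ] [AddCommGroup Γ] in
/-- The Laurent series of a constant rational function. [folklore] -/
theorem coe_ratFunc_C (c : F) :
    (algebraMap (RatFunc F) (LaurentSeries F)) (RatFunc.C c) = HahnSeries.C c := by
  rw [← RatFunc.algebraMap_C, ← IsScalarTower.algebraMap_apply,
    Polynomial.algebraMap_hahnSeries_apply, Polynomial.coe_C, ofPowerSeries_C]

/-- Constants go to constants. [folklore] -/
theorem laurentAt_C {y : Γ} (hy : 0 < y) (c : F) :
    laurentAt hy (RatFunc.C c) = HahnSeries.C c := by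
  simp only [laurentAt, RingHom.coe_comp, Function.comp_apply]
  rw [coe_ratFunc_C]
  exact embDomainRingHom_C

/-- **Uniqueness**: a ring homomorphism `F(Z) → F⟦Γ⟧` fixing constants and sending `Z` to
`single y 1` is the Laurent expansion along `y`. [folklore] -/
theorem ringHom_eq_laurentAt {y : Γ} (hy : 0 < y) (Φ : RatFunc F →+* HahnSeries Γ F)
    (hC : ∀ c : F, Φ (RatFunc.C c) = HahnSeries.C c) (hX : Φ RatFunc.X = single y 1) :
    Φ = laurentAt hy := by
  -- the two maps agree on polynomials
  have hpoly : Φ.comp (algebraMap F[X] (RatFunc F)) =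
      (laurentAt hy).comp (algebraMap F[X] (RatFunc F)) := by
    refine Polynomial.ringHom_ext (fun c ↦ ?_) ?_
    · simp only [RingHom.coe_comp, Function.comp_apply, RatFunc.algebraMap_C]
      rw [hC, laurentAt_C]
    · simp only [RingHom.coe_comp, Function.comp_apply, RatFunc.algebraMap_X]
      rw [hX, laurentAt_X]
  refine RingHom.ext fun r ↦ ?_
  refine RatFunc.induction_on (P := fun r ↦ Φ r = laurentAt hy r) r fun f g hg ↦ ?_
  have hf := congrArg (fun ψ : F[X] →+* HahnSeries Γ F ↦ ψ f) hpoly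
  have hgg := congrArg (fun ψ : F[X] →+* HahnSeries Γ F ↦ ψ g) hpoly
  simp only [RingHom.coe_comp, Function.comp_apply] at hf hgg
  rw [map_div₀, map_div₀, hf, hgg]

/-- A rational function whose Laurent expansion at `0` has no non-constant terms is a constant.
[folklore] -/
theorem eq_C_of_coeff_eq_zero (r : RatFunc F)
    (h : ∀ t : ℤ, t ≠ 0 → (r : LaurentSeries F).coeff t = 0) :
    r = RatFunc.C ((r : LaurentSeries F).coeff 0) := by
  have hinj : Function.Injective (algebraMap (RatFunc F) (LaurentSeries F)) :=
    (algebraMap (RatFunc F) (LaurentSeries F)).injective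
  apply hinj
  rw [coe_ratFunc_C]
  ext t
  by_cases ht : t = 0
  · subst ht; simp
  · rw [h t ht]; simp [ht]

end LaurentAt

/-! ### Sinnott's lemma -/

section Sinnott

/-- **Sinnott's lemma (Astérisque 147–148, Appendix; Invent. Math. 75, Prop. 3.1)** in Hahn
series form.  Let `y_j ∈ Γ` (`j ∈ J`) be positive and pairwise rationally independent: `a • y_i
= b • y_j` with `a ≠ 0` forces `i = j`.  Let `Φ_j : F(Z) →+* F⟦Γ⟧` be ring homomorphisms fixing
the constants with `Φ_j(Z) = single y_j 1` ("`r ↦ r(Y_j)`" for the monomial `Y_j`), and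
`u_j ∈ F(Z)`.  If `∑_{j∈J} Φ_j(u_j) = 0` then every `u_j`, `j ∈ J`, is a constant.
Proof: `Φ_j(u_j)` is the Laurent expansion of `u_j` along `y_j`, supported on `ℤ • y_j`; the
coefficient of the sum at `t • y_j` (`t ≠ 0`) is the `t`-th Laurent coefficient of `u_j`, since
`t • y_j ∉ ℤ • y_i` for `i ≠ j`. [cite: Sinnott1987, Appendix (p. 223)]
[cite: Sinnott1984, Prop. 3.1] -/
theorem isConstant_of_sum_ringHom_eq_zero {ι : Type*} (J : Finset ι) {y : ι → Γ}
    (hy : ∀ j ∈ J, 0 < y j)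
    (hind : ∀ i ∈ J, ∀ j ∈ J, ∀ a b : ℤ, a ≠ 0 → a • y i = b • y j → i = j)
    (Φ : ι → RatFunc F →+* HahnSeries Γ F)
    (hΦC : ∀ j ∈ J, ∀ c : F, Φ j (RatFunc.C c) = HahnSeries.C c)
    (hΦX : ∀ j ∈ J, Φ j RatFunc.X = single (y j) 1) (u : ι → RatFunc F)
    (hsum : ∑ j ∈ J, Φ j (u j) = 0) :
    ∀ j ∈ J, ∃ c : F, u j = RatFunc.C c := by
  have hΦ : ∀ j (hj : j ∈ J), Φ j = laurentAt (hy j hj) :=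
    fun j hj ↦ ringHom_eq_laurentAt (hy j hj) (Φ j) (hΦC j hj) (hΦX j hj)
  intro j hj
  refine ⟨_, eq_C_of_coeff_eq_zero (u j) fun t ht ↦ ?_⟩
  -- the coefficient of the sum at `t • y j`
  have hcoeff := congrArg (fun x : HahnSeries Γ F ↦ x.coeff (t • y j)) hsum
  simp only [HahnSeries.coeff_zero] at hcoeff
  rw [HahnSeries.coeff_sum] at hcoeff
  rw [Finset.sum_eq_single_of_mem j hj] at hcoeff
  · rwa [hΦ j hj, laurentAt_coeff_zsmul] at hcoeff
  · intro i hi hij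
    rw [hΦ i hi]
    refine laurentAt_coeff_eq_zero (hy i hi) (u i) fun s hs ↦ hij ?_
    exact (hind j hj i hi t s ht hs.symm).symm

end Sinnott

end Literature.NumberTheory.LFunctions.Sinnott1987
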